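import Summits.BirchSwinnertonDyer.BirchSwinnertonDyer.Theorems.Rank1ResidualPartitionEmptyCells
import Summits.BirchSwinnertonDyer.Rank1Residual.X12.CMRamifiedReducible
import Summits.BirchSwinnertonDyer.Rank1Residual.X12.CMRamifiedAdditive
import HarnessLib

set_option linter.dupNamespace false
set_option autoImplicit false

/-!
# Partition lemma — hyp part 5 / tree part 7: the CM-RAMIFIED kernel-empty cells (harvest-1 gen 16)
(`Summits/BirchSwinnertonDyer/BirchSwinnertonDyer/Theorems/Rank1ResidualPartitionEmptyCellsCM.lean`)

HONEST FRAMING (cell `b2b-bsdres`, run/shared/lean/b2b/bsd-rank1-residual/, verbatim in every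
file): the goal of the cell is to DELETE the COMBINATION-SHAPED residual classes of the
Birch–Swinnerton-Dyer formula for ALL analytic-rank `≤ 1` elliptic curves over `ℚ` — "full BSD
formula for every rank `≤ 1` curve in class `C`" assembled STRICTLY from published theorems — so
that the rank-`≤ 1` remainder becomes exactly the CONSTRUCTION-SHAPED classes, which are TYPED
(missing-input `Prop`s), NOT attempted. This is not "finishing BSD". Prove what is provable now;
shrink each hard class to its core with data; no claim beyond stated classes.

Theorems only; APPEND to part 4 (`…EmptyCells.lean`, p206258): nothing there or in lit's parts 1–5
is edited. harvest-1 gen 16 landed two more class-free warrants (p205907 `X12.red_of_cmRamified`: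
`HasCM ∧ p odd ∧ CMRamified ⟹ Red`; p206270 `X12.not_good_of_cmRamified`: `… ⟹ ¬Good`) and asked
whether `CellOf` wants their cell shapes (INBOX 04:31Z). They are:

* E6 `cm ∧ p odd ∧ cmRam ∧ irr` — empty by `X12.red_of_cmRamified`;
* E7 `cm ∧ p odd ∧ cmRam ∧ good` — empty by `X12.not_good_of_cmRamified`

(harvest-1's third shape `cm ∧ good ∧ red, p odd` is E3 ∨ E7 at cell level, so it needs no family).
`Cell.kernelEmpty₂ := kernelEmpty ∨ E6 ∨ E7`, `Cell.consistent₃ := consistent ∧ ¬kernelEmpty₂`;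
`cellOf_consistent₃` for every real pair. Kernel statements (`decide +kernel` over all 36 864 cells):
(S4) on `consistent₃` cells the X12 verdict is exactly `cm ∧ r = 1 ∧ p odd ∧ additive ∧ ¬cmSplit ∧
((cmRam ∧ red) ∨ (¬cmRam ∧ irr))` — X12 = CM-additive, RAMIFIED-REDUCIBLE (X3-shaped) ⊔
INERT-IRREDUCIBLE (X4-shaped); (S5) a `consistent₃` C10 or C17 cell is `irr ∧ ¬cmRam`; (S6) on
`consistent₃` cells with `cm ∧ p odd`, `irr = !cmRam` (harvest-1's dichotomy
`irr_iff_not_cmRamified_of_hasCM` at cell level). Kernel counts: `consistent₃` 7 856 (416 of the 8 272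
`consistent₂` cells are E6/E7-empty); X12 128 → 80. Per-verdict table by two engines (B Python /
A′ Lean `#eval`) in HOME/PARTITION.md §9. Nothing is booked; labels unchanged; no named fact is
introduced; axioms standard. hyp seat GEN 10.
-/

/-! Cell-level declarations: dot-notation extensions of `Summit.BirchSwinnertonDyer.Rank1Residual.Cell`
(Partition/Grid.lean), declared with absolute names (lean/CONVENTIONS.md §2). -/

namespace Summit.BirchSwinnertonDyer.Rank1Residual.Cell

variable (c : Cell)

/-! ## §1 The two CM-ramified families -/

/-- E6: `cm ∧ p odd ∧ p ∣ d_K ∧ irr(p)` (harvest-1: a CM curve is reducible at every odd prime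
ramified in `K`). [folklore] -/
def emptyCMRamIrr : Bool := c.cm && c.odd && c.cmRam && c.irr
/-- E7: `cm ∧ p odd ∧ p ∣ d_K ∧ good(p)` (harvest-1: a CM curve has bad — indeed additive —
reduction at every odd prime ramified in `K`). [folklore] -/
def emptyCMRamGood : Bool := c.cm && c.odd && c.cmRam && c.good

/-- The cell lies in one of the seven kernel-empty families E1–E7. [folklore] -/
def kernelEmpty₂ : Bool := c.kernelEmpty || c.emptyCMRamIrr || c.emptyCMRamGood

/-- Refined consistency, third level: part 1's four constraints and none of E1–E7. [folklore] -/
def consistent₃ : Bool := c.consistent && !c.kernelEmpty₂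

/-- `consistent₃` refines `consistent₂`. [folklore] -/
theorem consistent₂_of_consistent₃ (h : c.consistent₃ = true) : c.consistent₂ = true := by
  simp only [consistent₃, consistent₂, kernelEmpty₂, Bool.and_eq_true, Bool.not_eq_true',
    Bool.or_eq_false_iff] at h ⊢
  exact ⟨h.1, h.2.1.1⟩

/-- The X12 core shape, third level: CM-additive, ramified-reducible or inert-irreducible.
[folklore] -/
def x12Core₃ : Bool :=
  c.cm && c.r1 && c.odd && c.addv && !c.cmSplit && ((c.cmRam && c.isRed) || (!c.cmRam && c.irr))

/-- Specification S4: on `consistent₃` cells, verdict X12 ⟺ `x12Core₃`. [folklore] -/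
def x12Core₃Spec : Bool := (c.consistent₃ && c.isX12) == (c.consistent₃ && c.x12Core₃)

/-- Specification S5: a `consistent₃` C10 / C17 cell is irreducible and unramified in `K`. [folklore] -/
def cmCoveredIrrSpec : Bool :=
  !(c.consistent₃ && (c.hasVerdict (.covered .C10) || c.hasVerdict (.covered .C17))) ||
    (c.irr && !c.cmRam)

/-- Specification S6: on `consistent₃` cells with `cm ∧ p odd`, `irr = !cmRam`. [folklore] -/
def cmDichotomySpec : Bool := !(c.consistent₃ && c.cm && c.odd) || (c.irr == !c.cmRam)

/-! ## §2 The finite verification -/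

/-- Raw form of S4. [folklore] -/
theorem x12Core₃_spec_raw :
    ∀ (pk : PK) (red : RedK) (im : ImK) (bigIm : Bool) (rk : RK)
      (cm ram sst anom gvpar a3zero cmSplit cmRam : Bool),
      (Cell.mk pk red im bigIm rk cm ram sst anom gvpar a3zero cmSplit cmRam).x12Core₃Spec = true := by
  decide +kernel

/-- **S4.** On the third-level grid the X12 verdict is exactly the CM-additive shape, split as
ramified-reducible ⊔ inert-irreducible. [folklore] -/
theorem x12Core₃_spec (c : Cell) : (c.consistent₃ && c.isX12) = (c.consistent₃ && c.x12Core₃) := by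
  obtain ⟨pk, red, im, bigIm, rk, cm, ram, sst, anom, gvpar, a3zero, cmSplit, cmRam⟩ := c
  have h := x12Core₃_spec_raw pk red im bigIm rk cm ram sst anom gvpar a3zero cmSplit cmRam
  simpa only [x12Core₃Spec, beq_iff_eq] using h

/-- S4, implication form. [folklore] -/
theorem x12Core₃_of_classify (c : Cell) (hc : c.consistent₃ = true)
    (h : c.classify = .residual .X12) : c.x12Core₃ = true := by
  have hs := x12Core₃_spec c
  have hx : c.isX12 = true := by simpa [isX12] using h
  simpa [hc, hx] using hs.symm

/-- Raw form of S5. [folklore] -/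
theorem cmCoveredIrr_spec_raw :
    ∀ (pk : PK) (red : RedK) (im : ImK) (bigIm : Bool) (rk : RK)
      (cm ram sst anom gvpar a3zero cmSplit cmRam : Bool),
      (Cell.mk pk red im bigIm rk cm ram sst anom gvpar a3zero cmSplit cmRam).cmCoveredIrrSpec = true := by
  decide +kernel

/-- Cell form of S5. [folklore] -/
theorem cmCoveredIrr_spec (c : Cell) : c.cmCoveredIrrSpec = true := by
  obtain ⟨pk, red, im, bigIm, rk, cm, ram, sst, anom, gvpar, a3zero, cmSplit, cmRam⟩ := c
  exact cmCoveredIrr_spec_raw pk red im bigIm rk cm ram sst anom gvpar a3zero cmSplit cmRam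

/-- **S5.** A third-level-consistent cell classified C10 or C17 is irreducible and unramified in
`K`. [folklore] -/
theorem irr_notRam_of_C10_C17 (c : Cell) (hc : c.consistent₃ = true)
    (hv : c.hasVerdict (.covered .C10) = true ∨ c.hasVerdict (.covered .C17) = true) :
    c.irr = true ∧ c.cmRam = false := by
  have h := cmCoveredIrr_spec c
  rcases hv with hv | hv <;> simpa [cmCoveredIrrSpec, hc, hv] using h

/-- Raw form of S6. [folklore] -/
theorem cmDichotomy_spec_raw :
    ∀ (pk : PK) (red : RedK) (im : ImK) (bigIm : Bool) (rk : RK)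
      (cm ram sst anom gvpar a3zero cmSplit cmRam : Bool),
      (Cell.mk pk red im bigIm rk cm ram sst anom gvpar a3zero cmSplit cmRam).cmDichotomySpec = true := by
  decide +kernel

/-- Cell form of S6. [folklore] -/
theorem cmDichotomy_spec (c : Cell) : c.cmDichotomySpec = true := by
  obtain ⟨pk, red, im, bigIm, rk, cm, ram, sst, anom, gvpar, a3zero, cmSplit, cmRam⟩ := c
  exact cmDichotomy_spec_raw pk red im bigIm rk cm ram sst anom gvpar a3zero cmSplit cmRam

/-- **S6.** On third-level-consistent CM cells at odd `p`, `irr = !cmRam`. [folklore] -/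
theorem irr_eq_not_cmRam (c : Cell) (hc : c.consistent₃ = true) (hcm : c.cm = true)
    (ho : c.odd = true) : c.irr = !c.cmRam := by
  have h := cmDichotomy_spec c
  simpa [cmDichotomySpec, hc, hcm, ho] using h

/-! ## §2b Two kernel counts (headline numbers; the per-verdict table is certified outside the
tree by engines B / A′, HOME/b2b-bsdres-hyp/hyp/partition2/) -/

/-- **7 856 cells are third-level consistent; 416 `consistent₂` cells are E6/E7-empty.** [folklore] -/
theorem count_consistent₃ :
    count (·.consistent₃) = 7856 ∧
    count (fun c => c.consistent₂ && (c.emptyCMRamIrr || c.emptyCMRamGood)) = 416 := by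
  constructor <;> decide +kernel

/-- **X12: 80 third-level-consistent cells** (part 4: 128 at level 2, 480 at level 1). [folklore] -/
theorem count_X12₃ : count (fun c => c.consistent₃ && c.isX12) = 80 := by
  decide +kernel

end Summit.BirchSwinnertonDyer.Rank1Residual.Cell

/-! ## §3 Real pairs -/

namespace Summit.BirchSwinnertonDyer.BirchSwinnertonDyer.Rank1Residual.Partition

open WeierstrassCurve Literature.NumberTheory.EllipticCurves
  Literature.NumberTheory.EllipticCurves.Rank1Residual Summit.BirchSwinnertonDyer.Rank1Residual

section Curve

open scoped Classical

variable (W : WeierstrassCurve ℚ) [W.IsElliptic] [W.IsGloballyMinimal] (p : ℕ) [Fact p.Prime]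

/-- E6 on real pairs: `cm ∧ p odd ∧ cmRam ⇒ red(p)` (harvest-1 `X12.red_of_cmRamified`). [folklore] -/
theorem cellOf_emptyCMRamIrr : (cellOf W p).emptyCMRamIrr = false := by
  by_cases h : W.HasCM ∧ p ≠ 2 ∧ CMRamified W p
  · have hi : (cellOf W p).irr = false := by
      rw [Bool.eq_false_iff, ne_eq, cellOf_irr]
      exact X12.red_of_cmRamified W p h.1 h.2.1 h.2.2
    simp [Cell.emptyCMRamIrr, hi]
  · rcases not_and_or.mp h with hcm | h'
    · simp [Cell.emptyCMRamIrr, (cellOf_cm_false W p).2 hcm]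
    · rcases not_and_or.mp h' with h2 | hr
      · have ho : (cellOf W p).odd = false := by
          rw [Bool.eq_false_iff, ne_eq, cellOf_odd]
          exact h2
        simp [Cell.emptyCMRamIrr, ho]
      · have hc : (cellOf W p).cmRam = false := by
          rw [Bool.eq_false_iff, ne_eq, cellOf_cmRam]
          exact hr
        simp [Cell.emptyCMRamIrr, hc]

/-- E7 on real pairs: `cm ∧ p odd ∧ cmRam ⇒ ¬good(p)` (harvest-1 `X12.not_good_of_cmRamified`).
[folklore] -/
theorem cellOf_emptyCMRamGood : (cellOf W p).emptyCMRamGood = false := by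
  by_cases h : W.HasCM ∧ p ≠ 2 ∧ CMRamified W p
  · have hg : (cellOf W p).good = false :=
      (cellOf_good_false W p).2 (X12.not_good_of_cmRamified W p h.1 h.2.1 h.2.2)
    simp [Cell.emptyCMRamGood, hg]
  · rcases not_and_or.mp h with hcm | h'
    · simp [Cell.emptyCMRamGood, (cellOf_cm_false W p).2 hcm]
    · rcases not_and_or.mp h' with h2 | hr
      · have ho : (cellOf W p).odd = false := by
          rw [Bool.eq_false_iff, ne_eq, cellOf_odd]
          exact h2
        simp [Cell.emptyCMRamGood, ho]
      · have hc : (cellOf W p).cmRam = false := by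
          rw [Bool.eq_false_iff, ne_eq, cellOf_cmRam]
          exact hr
        simp [Cell.emptyCMRamGood, hc]

/-- **The cell of a real pair is in none of E1–E7.** [folklore] -/
theorem cellOf_kernelEmpty₂ : (cellOf W p).kernelEmpty₂ = false := by
  simp [Cell.kernelEmpty₂, cellOf_kernelEmpty, cellOf_emptyCMRamIrr, cellOf_emptyCMRamGood]

/-- **The cell of a real pair is third-level consistent.** [folklore] -/
theorem cellOf_consistent₃ : (cellOf W p).consistent₃ = true := by
  simp [Cell.consistent₃, cellOf_consistent, cellOf_kernelEmpty₂]

/-- **Every pair the table sends to X12 is CM-additive at an odd `p` not split in `K`, and is either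
ramified-reducible or inert-irreducible** (S4 transported to curves). [folklore] -/
theorem classify_cellOf_eq_X12_imp₃ (h : Cell.classify (cellOf W p) = .residual .X12) :
    W.HasCM ∧ Addv W p ∧ p ≠ 2 ∧ ¬ CMSplit W p ∧
      ((CMRamified W p ∧ Red W p) ∨ (¬ CMRamified W p ∧ Irr W p)) := by
  have hx := Cell.x12Core₃_of_classify _ (cellOf_consistent₃ W p) h
  simp only [Cell.x12Core₃, Bool.and_eq_true, Bool.or_eq_true, Bool.not_eq_true'] at hx
  obtain ⟨⟨⟨⟨⟨hcm, -⟩, hodd⟩, hadd⟩, hsplit⟩, hshape⟩ := hx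
  refine ⟨(cellOf_cm W p).1 hcm, (cellOf_addv W p).1 hadd, (cellOf_odd W p).1 hodd,
    (cellOf_cmSplit_false W p).1 hsplit, ?_⟩
  rcases hshape with ⟨hram, hred⟩ | ⟨hram, hirr⟩
  · exact Or.inl ⟨(cellOf_cmRam W p).1 hram, (cellOf_isRed W p).1 hred⟩
  · refine Or.inr ⟨fun hR => ?_, (cellOf_irr W p).1 hirr⟩
    have := (cellOf_cmRam W p).2 hR
    rw [hram] at this
    exact Bool.false_ne_true this

end Curve

end Summit.BirchSwinnertonDyer.BirchSwinnertonDyer.Rank1Residual.Partition
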